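import Mathlib.Analysis.SpecialFunctions.PolarCoord
import Mathlib.Analysis.Complex.MeanValue
import Mathlib.MeasureTheory.Integral.CircleAverage
import Mathlib.MeasureTheory.Constructions.Pi
import Mathlib.MeasureTheory.Integral.Prod
import Mathlib.MeasureTheory.Function.ContinuousMapDense
import HarnessLib

/-!
# The weighted mean value property of holomorphic functions over discs and polydiscs

Topic `Literature/Analysis/Complex`. The mean value property `f(c) = (2π)⁻¹ ∫ f(c + t e^{iθ}) dθ`
of a holomorphic function, integrated against a radial weight `b(t)` in the radius, becomes an
*area* mean value property with a *smooth* kernel,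

  `∫_ℂ b(|w|) g(w) dA(w) = (∫_ℂ b(|w|) dA) · g(0)`      (`integral_radial_smul_eq_smul`),

for `g` holomorphic on a neighbourhood of the closed disc `|w| ≤ R` and `b` continuous with
`b(t) = 0` for `t ≥ R` (polar coordinates, Mathlib's `Complex.integral_comp_polarCoord_symm`, and the
circle mean value `DiffContOnCl.circleAverage`). Iterating over the coordinates of `ℂ^N`
(`MeasureTheory.volume_preserving_piFinSuccAbove`, Fubini) gives the **weighted mean value property
over polydiscs along arbitrary directions** `v₁, …, v_N` of a complex normed space `E`:

  `∫_{ℂ^N} (∏ᵢ b(|wᵢ|)) f(z₀ + ∑ᵢ wᵢ vᵢ) dA(w) = (∫_ℂ b(|w|) dA)^N · f(z₀)`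
  (`integral_pi_radial_smul_eq_smul`),

for `f` holomorphic on an open `U ⊆ E` containing the closed polydisc `{z₀ + ∑ wᵢvᵢ : |wᵢ| ≤ R}`.
This is the device by which bounds on *smeared* values `∫ f(x + iy) F(x) dx` of a holomorphic
function on a tube (with smooth compactly supported `F`) are turned into pointwise bounds
(`Literature/Analysis/Distribution/RayBoundaryValueGrowth.lean`): the real slices of the product
kernel are smooth test functions. Everything here is PROVED; classical (Rudin, *Function Theory in
the Unit Ball of ℂⁿ*, §1.1; Hörmander, *An Introduction to Complex Analysis in Several Variables*,
Thm. 2.2.1 and its proof). [folklore]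

## Mathlib

Used: `Complex.integral_comp_polarCoord_symm`, `Complex.polarCoord_symm_apply`,
`DiffContOnCl.circleAverage` (mean value property), `Real.circleAverage_eq_integral_add`,
`MeasureTheory.setIntegral_prod`, `MeasureTheory.integral_prod`,
`MeasureTheory.volume_preserving_piFinSuccAbove`, `MeasurableEquiv.piFinSuccAbove_symm_apply`,
`MeasureTheory.Measure.pi_of_empty`. Mathlib has the circle mean value property and torus integrals
but (at this pin) no polydisc/area mean value statement.
-/

noncomputable section

open MeasureTheory Metric Set Filter Real
open _root_.Complex
open scoped Topology

namespace Literature.Analysis.Complex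

/-! ### Continuity of weighted functions -/

/-- If `φ` is continuous with `tsupport φ ⊆ O`, `O` open, and `h` is continuous on `O`, then
`x ↦ φ x • h x` is continuous (it vanishes near every point outside `O`). [folklore] -/
theorem continuous_smul_of_tsupport_subset {X : Type*} [TopologicalSpace X] {F : Type*}
    [NormedAddCommGroup F] [NormedSpace ℝ F] {φ : X → ℝ} {h : X → F} {O : Set X}
    (hO : IsOpen O) (hφ : Continuous φ) (hsupp : tsupport φ ⊆ O) (hh : ContinuousOn h O) :
    Continuous fun x => φ x • h x := by
  rw [continuous_iff_continuousAt]
  intro x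
  by_cases hx : x ∈ O
  · exact (hφ.continuousAt).smul (hh.continuousAt (hO.mem_nhds hx))
  · have hx' : x ∉ tsupport φ := fun h' => hx (hsupp h')
    have h0 : (fun y => φ y • h y) =ᶠ[𝓝 x] fun _ => 0 := by
      have : φ =ᶠ[𝓝 x] 0 := by rwa [← notMem_tsupport_iff_eventuallyEq]
      filter_upwards [this] with y hy
      simp [hy]
    exact (continuousAt_congr h0).2 continuousAt_const

/-! ### One complex variable: polar coordinates and the circle mean value -/

section OneVariable

variable {F : Type*} [NormedAddCommGroup F] [NormedSpace ℂ F]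

/-- `Complex.polarCoord.symm (t, θ) = circleMap 0 t θ`. [folklore] -/
theorem polarCoord_symm_eq_circleMap (p : ℝ × ℝ) :
    Complex.polarCoord.symm p = circleMap 0 p.1 p.2 := by
  rw [Complex.polarCoord_symm_apply, circleMap, zero_add, Complex.exp_mul_I, Complex.ofReal_cos,
    Complex.ofReal_sin]

/-- The map `Complex.polarCoord.symm` is continuous on all of `ℝ²`. [folklore] -/
theorem continuous_polarCoord_symm' : Continuous fun p : ℝ × ℝ => Complex.polarCoord.symm p := by
  simp only [polarCoord_symm_eq_circleMap, circleMap, zero_add]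
  fun_prop

/-- **The circle mean value over `(-π, π]`**: for `g` holomorphic on an open set containing the
closed disc `|w - c| ≤ t`, `t > 0`, `∫_{-π}^{π} g(c + t e^{iθ}) dθ = 2π g(c)` (Mathlib's
`DiffContOnCl.circleAverage`, shifted from `[0, 2π]`). [folklore] -/
theorem intervalIntegral_circleMap_eq [CompleteSpace F] {g : ℂ → F} {U₁ : Set ℂ}
    (hg : DifferentiableOn ℂ g U₁) {c : ℂ} {t : ℝ} (ht : 0 < t) (hsub : closedBall c t ⊆ U₁) :
    ∫ θ in (-π)..π, g (circleMap c t θ) = (2 * π) • g c := by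
  have hd : DiffContOnCl ℂ g (ball c |t|) := by
    refine DifferentiableOn.diffContOnCl (hg.mono ?_)
    rw [abs_of_pos ht, closure_ball c ht.ne']
    exact hsub
  have hmv := hd.circleAverage
  rw [circleAverage_eq_integral_add (-π), intervalIntegral.integral_comp_add_right
    (fun θ => g (circleMap c t θ)) (-π)] at hmv
  simp only [zero_add] at hmv
  rw [show 2 * π + -π = π by ring] at hmv
  rw [← hmv, smul_smul, mul_inv_cancel₀ (by positivity), one_smul]

variable {F' : Type*} [NormedAddCommGroup F'] [NormedSpace ℝ F']

/-- **Polar coordinates for a radially weighted integrand**: for `b` continuous with `b(t) = 0` for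
`t ≥ R` and `h` continuous on the closed disc of radius `R`,
`∫_ℂ b(|w|) h(w) dA = ∫_0^∞ t b(t) (∫_{-π}^{π} h(t e^{iθ}) dθ) dt`. [folklore] -/
theorem integral_radial_smul_eq_integral_Ioi {b : ℝ → ℝ} (hb : Continuous b) {R : ℝ} (hR : 0 < R)
    (hbR : ∀ t, R ≤ t → b t = 0) {h : ℂ → F'} (hh : ContinuousOn h (closedBall (0 : ℂ) R)) :
    ∫ w, b ‖w‖ • h w = ∫ t in Ioi (0 : ℝ), (t * b t) • ∫ θ in (-π)..π, h (circleMap 0 t θ) := by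
  rw [← Complex.integral_comp_polarCoord_symm]
  change ∫ p in Ioi (0 : ℝ) ×ˢ Ioo (-π) π, _ = _
  set Fp : ℝ × ℝ → F' := fun p => p.1 • (b ‖Complex.polarCoord.symm p‖ • h (Complex.polarCoord.symm p))
    with hFp
  -- continuity on the compact box `[0, R] × [-π, π]`
  have hcont : ContinuousOn Fp (Icc 0 R ×ˢ Icc (-π) π) := by
    have hps : Continuous fun p : ℝ × ℝ => Complex.polarCoord.symm p := continuous_polarCoord_symm'
    have hmaps : MapsTo (fun p : ℝ × ℝ => Complex.polarCoord.symm p) (Icc 0 R ×ˢ Icc (-π) π)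
        (closedBall (0 : ℂ) R) := by
      intro p hp
      rw [mem_closedBall_zero_iff, Complex.norm_polarCoord_symm, abs_le]
      exact ⟨by linarith [hp.1.1], hp.1.2⟩
    refine continuous_fst.continuousOn.smul ((hb.comp (continuous_norm.comp hps)).continuousOn.smul
      (hh.comp hps.continuousOn hmaps))
  -- integrability on the target `(0, ∞) × (-π, π)`
  have hint : IntegrableOn Fp (Ioi (0 : ℝ) ×ˢ Ioo (-π) π) (volume.prod volume) := by
    rw [← Measure.volume_eq_prod, ← Ioc_union_Ioi_eq_Ioi hR.le, union_prod]
    refine IntegrableOn.union ?_ ?_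
    · exact (hcont.integrableOn_compact (isCompact_Icc.prod isCompact_Icc)).mono_set
        (prod_mono Ioc_subset_Icc_self Ioo_subset_Icc_self)
    · refine IntegrableOn.congr_fun (f := fun _ => (0 : F')) integrableOn_zero (fun p hp => ?_)
        (measurableSet_Ioi.prod measurableSet_Ioo)
      have h1 : R ≤ |p.1| := (le_of_lt hp.1).trans (le_abs_self _)
      simp [hFp, hbR _ h1]
  rw [Measure.volume_eq_prod, setIntegral_prod Fp hint]
  refine setIntegral_congr_fun measurableSet_Ioi fun t ht => ?_
  have ht0 : 0 < t := ht
  simp only [hFp, polarCoord_symm_eq_circleMap, norm_circleMap_zero, abs_of_pos ht0]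
  rw [integral_smul, integral_smul, smul_smul, intervalIntegral.integral_of_le (by linarith [pi_pos]),
    integral_Ioc_eq_integral_Ioo]

/-- **The radial mass** `∫_ℂ b(|w|) dA = 2π ∫_0^∞ t b(t) dt`. [folklore] -/
theorem integral_radial_eq {b : ℝ → ℝ} (hb : Continuous b) {R : ℝ} (hR : 0 < R)
    (hbR : ∀ t, R ≤ t → b t = 0) :
    ∫ w : ℂ, b ‖w‖ = ∫ t in Ioi (0 : ℝ), t * b t * (2 * π) := by
  have h := integral_radial_smul_eq_integral_Ioi hb hR hbR (h := fun _ : ℂ => (1 : ℝ))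
    continuousOn_const
  simp only [smul_eq_mul, mul_one, intervalIntegral.integral_const] at h
  rw [h]
  refine setIntegral_congr_fun measurableSet_Ioi fun t _ => ?_
  ring

/-- **Weighted area mean value property on a disc.** For `g` holomorphic on an open set containing
the closed disc `|w| ≤ R` and a continuous radial weight `b` with `b(t) = 0` for `t ≥ R`:
`∫_ℂ b(|w|) g(w) dA(w) = (∫_ℂ b(|w|) dA) · g(0)`. Proof: polar coordinates and the circle mean value
property radius by radius. [folklore] -/
theorem integral_radial_smul_eq_smul [CompleteSpace F] {b : ℝ → ℝ} (hb : Continuous b) {R : ℝ}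
    (hR : 0 < R) (hbR : ∀ t, R ≤ t → b t = 0) {g : ℂ → F} {U₁ : Set ℂ}
    (hg : DifferentiableOn ℂ g U₁) (hsub : closedBall (0 : ℂ) R ⊆ U₁) :
    ∫ w, b ‖w‖ • g w = (∫ w : ℂ, b ‖w‖) • g 0 := by
  rw [integral_radial_smul_eq_integral_Ioi hb hR hbR (hg.continuousOn.mono hsub),
    integral_radial_eq hb hR hbR, ← integral_smul_const]
  refine setIntegral_congr_fun measurableSet_Ioi fun t ht => ?_
  have ht0 : 0 < t := ht
  by_cases htR : t ≤ R
  · rw [intervalIntegral_circleMap_eq hg ht0 ((closedBall_subset_closedBall htR).trans hsub),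
      smul_smul]
  · rw [hbR t (le_of_not_ge htR)]
    simp

end OneVariable

/-! ### Several variables: polydiscs along arbitrary directions -/

section SeveralVariables

variable {E : Type*} [NormedAddCommGroup E] [NormedSpace ℂ E]
variable {F : Type*} [NormedAddCommGroup F] [NormedSpace ℂ F]

/-- The affine parametrisation `w ↦ z₀ + ∑ wᵢ vᵢ` of the complex span of `v₁, …, v_N` through `z₀`
is continuous. [folklore] -/
theorem continuous_polydiscMap {N : ℕ} (z₀ : E) (v : Fin N → E) :
    Continuous fun w : Fin N → ℂ => z₀ + ∑ i, w i • v i := by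
  fun_prop

/-- The product weight `∏ᵢ b(|wᵢ|)` vanishes unless all `|wᵢ| < R₁`, when `b = 0` on `[R₁, ∞)`.
[folklore] -/
theorem prod_radial_eq_zero {N : ℕ} {b : ℝ → ℝ} {R₁ : ℝ} (hbR : ∀ t, R₁ ≤ t → b t = 0)
    {w : Fin N → ℂ} {i : Fin N} (hi : R₁ ≤ ‖w i‖) : ∏ j, b ‖w j‖ = 0 :=
  Finset.prod_eq_zero (Finset.mem_univ i) (hbR _ hi)

/-- **The weighted integrand is continuous with compact support**: for `f` continuous on an open
`U` containing the closed polydisc of radius `R` about `z₀` in the directions `v`, and `b`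
continuous vanishing on `[R₁, ∞)` with `R₁ < R`, the function
`w ↦ (∏ b(|wᵢ|)) • f(z₀ + ∑ wᵢvᵢ)` on `ℂ^N` is continuous and compactly supported. [folklore] -/
theorem continuous_prod_radial_smul {N : ℕ} {b : ℝ → ℝ} (hb : Continuous b) {R₁ R : ℝ}
    (hR : R₁ < R) (hbR : ∀ t, R₁ ≤ t → b t = 0) {f : E → F} {U : Set E}
    (hf : ContinuousOn f U) (z₀ : E) (v : Fin N → E)
    (hmem : ∀ w : Fin N → ℂ, (∀ i, ‖w i‖ ≤ R) → z₀ + ∑ i, w i • v i ∈ U) :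
    Continuous fun w : Fin N → ℂ => (∏ i, b ‖w i‖) • f (z₀ + ∑ i, w i • v i) := by
  set O : Set (Fin N → ℂ) := {w | ∀ i, ‖w i‖ < R} with hO
  have hOo : IsOpen O := by
    rw [hO, show {w : Fin N → ℂ | ∀ i, ‖w i‖ < R} = ⋂ i, {w | ‖w i‖ < R} by ext; simp]
    exact isOpen_iInter_of_finite fun i => isOpen_lt (continuous_norm.comp (continuous_apply i))
      continuous_const
  have hφ : Continuous fun w : Fin N → ℂ => ∏ i, b ‖w i‖ := by fun_prop
  have hsupp : tsupport (fun w : Fin N → ℂ => ∏ i, b ‖w i‖) ⊆ O := by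
    have hcl : IsClosed {w : Fin N → ℂ | ∀ i, ‖w i‖ ≤ R₁} := by
      rw [show {w : Fin N → ℂ | ∀ i, ‖w i‖ ≤ R₁} = ⋂ i, {w | ‖w i‖ ≤ R₁} by ext; simp]
      exact isClosed_iInter fun i => isClosed_le (continuous_norm.comp (continuous_apply i))
        continuous_const
    refine (closure_minimal (fun w hw => ?_) hcl).trans fun w hw i => (hw i).trans_lt hR
    intro i
    by_contra h
    exact hw (prod_radial_eq_zero hbR (le_of_not_ge h))
  refine continuous_smul_of_tsupport_subset hOo hφ hsupp ?_
  exact hf.comp (continuous_polydiscMap z₀ v).continuousOn fun w hw => hmem w fun i => (hw i).le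

/-- Compact support of the weighted integrand. [folklore] -/
theorem hasCompactSupport_prod_radial_smul {N : ℕ} {b : ℝ → ℝ} {R₁ : ℝ} (hR₁ : 0 ≤ R₁)
    (hbR : ∀ t, R₁ ≤ t → b t = 0) (f : E → F) (z₀ : E) (v : Fin N → E) :
    HasCompactSupport fun w : Fin N → ℂ => (∏ i, b ‖w i‖) • f (z₀ + ∑ i, w i • v i) := by
  refine HasCompactSupport.intro (isCompact_closedBall (0 : Fin N → ℂ) R₁) fun w hw => ?_
  rw [mem_closedBall_zero_iff, pi_norm_le_iff_of_nonneg hR₁] at hw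
  push Not at hw
  obtain ⟨i, hi⟩ := hw
  rw [prod_radial_eq_zero hbR hi.le, zero_smul]

/-- **Weighted mean value property over polydiscs along arbitrary directions.** Let `b` be a
continuous weight with `b(t) = 0` for `t ≥ R₁`, `0 < R₁ < R`, `f` holomorphic on an open `U ⊆ E`, and
suppose the closed polydisc `{z₀ + ∑ᵢ wᵢ vᵢ : |wᵢ| ≤ R}` lies in `U`. Then

  `∫_{ℂ^N} (∏ᵢ b(|wᵢ|)) f(z₀ + ∑ᵢ wᵢ vᵢ) dA(w) = (∫_ℂ b(|w|) dA)^N f(z₀)`.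

Proof: induction on `N`, splitting off the first coordinate (`ℂ^{N+1} ≃ ℂ × ℂ^N` is measure
preserving), Fubini, the induction hypothesis at the centres `z₀ + w₀ v₀`, and the one-variable
weighted mean value property in `w₀`. [folklore] -/
theorem integral_pi_radial_smul_eq_smul [CompleteSpace F] {b : ℝ → ℝ} (hb : Continuous b)
    {R₁ R : ℝ} (hR₁ : 0 < R₁) (hR : R₁ < R) (hbR : ∀ t, R₁ ≤ t → b t = 0) {f : E → F} {U : Set E}
    (hf : DifferentiableOn ℂ f U) :
    ∀ (N : ℕ) (z₀ : E) (v : Fin N → E),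
      (∀ w : Fin N → ℂ, (∀ i, ‖w i‖ ≤ R) → z₀ + ∑ i, w i • v i ∈ U) →
        ∫ w : Fin N → ℂ, (∏ i, b ‖w i‖) • f (z₀ + ∑ i, w i • v i) =
          (∫ w : ℂ, b ‖w‖) ^ N • f z₀ := by
  intro N
  induction N with
  | zero =>
    intro z₀ v _
    rw [volume_pi, Measure.pi_of_empty (fun _ : Fin 0 => (volume : Measure ℂ)) (fun i => i.elim0),
      integral_dirac]
    simp
  | succ N ih =>
    intro z₀ v hmem
    have hbR' : ∀ t, R ≤ t → b t = 0 := fun t ht => hbR t (hR.le.trans ht)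
    -- split off the first coordinate
    have hmp := (volume_preserving_piFinSuccAbove (fun _ : Fin (N + 1) => ℂ) 0).symm
    set G : (Fin (N + 1) → ℂ) → F := fun w => (∏ i, b ‖w i‖) • f (z₀ + ∑ i, w i • v i) with hG
    have hGint : Integrable G := (continuous_prod_radial_smul hb hR hbR hf.continuousOn z₀ v
      hmem).integrable_of_hasCompactSupport (hasCompactSupport_prod_radial_smul hR₁.le hbR f z₀ v)
    rw [← hmp.integral_comp' G]
    have hGint' : Integrable (fun p : ℂ × (Fin N → ℂ) =>
        G ((MeasurableEquiv.piFinSuccAbove (fun _ : Fin (N + 1) => ℂ) 0).symm p))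
        (volume.prod volume) :=
      (hmp.integrable_comp_emb (MeasurableEquiv.measurableEmbedding _)).2 hGint
    rw [Measure.volume_eq_prod, integral_prod _ hGint']
    -- the integrand at `Fin.cons x w'`
    have hcons : ∀ (x : ℂ) (w' : Fin N → ℂ),
        G ((MeasurableEquiv.piFinSuccAbove (fun _ : Fin (N + 1) => ℂ) 0).symm (x, w')) =
          b ‖x‖ • ((∏ j, b ‖w' j‖) • f ((z₀ + x • v 0) + ∑ j, w' j • v j.succ)) := by
      intro x w'
      simp only [hG, MeasurableEquiv.piFinSuccAbove_symm_apply, Fin.insertNthEquiv_zero,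
        Fin.consEquiv_apply, Fin.prod_univ_succ, Fin.sum_univ_succ, Fin.cons_zero, Fin.cons_succ,
        smul_smul, add_assoc]
    simp_rw [hcons]
    -- the inner integral by the induction hypothesis (or zero)
    have hinner : ∀ x : ℂ, ∫ w' : Fin N → ℂ, b ‖x‖ • ((∏ j, b ‖w' j‖) •
        f ((z₀ + x • v 0) + ∑ j, w' j • v j.succ)) =
          b ‖x‖ • ((∫ w : ℂ, b ‖w‖) ^ N • f (z₀ + x • v 0)) := by
      intro x
      rw [integral_smul]
      by_cases hx : ‖x‖ ≤ R
      · rw [ih (z₀ + x • v 0) (fun j => v j.succ) fun w' hw' => ?_]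
        have h := hmem (Fin.cons x w') (Fin.cases hx hw')
        simpa only [Fin.sum_univ_succ, Fin.cons_zero, Fin.cons_succ, add_assoc] using h
      · rw [hbR' _ (le_of_not_ge hx), zero_smul, zero_smul]
    simp_rw [hinner]
    -- the outer integral by the one-variable weighted mean value property
    have hcomm : ∀ x : ℂ, b ‖x‖ • ((∫ w : ℂ, b ‖w‖) ^ N • f (z₀ + x • v 0)) =
        (∫ w : ℂ, b ‖w‖) ^ N • (b ‖x‖ • f (z₀ + x • v 0)) := fun x => smul_comm _ _ _
    simp_rw [hcomm]
    rw [integral_smul]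
    set U₁ : Set ℂ := {x | z₀ + x • v 0 ∈ U} with hU₁
    have hg : DifferentiableOn ℂ (fun x : ℂ => f (z₀ + x • v 0)) U₁ :=
      hf.comp (by fun_prop) fun x hx => hx
    have hsub : closedBall (0 : ℂ) R ⊆ U₁ := by
      intro x hx
      rw [mem_closedBall_zero_iff] at hx
      have h := hmem (Fin.cons x 0) (Fin.cases hx fun j => by simpa using hR₁.le.trans hR.le)
      show z₀ + x • v 0 ∈ U
      simpa [Fin.sum_univ_succ] using h
    rw [integral_radial_smul_eq_smul hb (hR₁.trans hR) hbR' hg hsub, zero_smul, add_zero,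
      smul_smul, ← pow_succ]

end SeveralVariables

end Literature.Analysis.Complex
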